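import Mathlib.Analysis.SpecificLimits.Basic
import Literature.MathematicalPhysics.QuantumLattice.LatticeGaugeDLR
import HarnessLib

/-!
# Asymptotically all sites of the box are good (helper T4 of line `Sketch`, crux `FibreToTorus`)

Pure lattice combinatorics on `ℤ^d` plus a limit, used by the lead's reduction of weak-coupling
uniqueness to Israel's unique-tangent form (tangent programme, sub-goal T4).  Fix a finite set of
edges `S ⊆ ℤ^d × {directions}` (the support of a local observable).  A site `x ∈ [0, n)^d` is
*good* if the translate `S + x` (add `x` to the base point of every edge) lies in the edge box
`[0, n+1)^d × {directions}`.  Then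

  `#{good sites of [0, n)^d} / (n + 1)^d ⟶ 1`  as `n → ∞`.

Proof: with `R` a bound on the sup-norm of the base points of `S`, every `x` with
`R ≤ x i < n - R` for all `i` is good, and these form a translate of `[0, n - 2R)^d`; so
`(n - 2R)^d ≤ #good ≤ n^d ≤ (n + 1)^d`, and both `((n - 2R)/(n + 1))^d` and `1` tend to `1`.
-/

noncomputable section
open MeasureTheory Filter Topology Finset
open Literature.Probability.LatticeModels (Site halfOpenBox)
open Literature.MathematicalPhysics.QuantumLattice (LGConfig ZdEdge)

namespace Summit.QuantumFields.YangMills.Theorems.FibreToTorus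

/-- **Lower bound on the number of good sites.**  If every base point of `S` has all coordinates
in `[-R, R]`, then for `n ≥ 2R` at least `(n - 2R)^d` sites `x ∈ [0, n)^d` have
`S + x ⊆ [0, n+1)^d × {directions}`: the translate `[0, n - 2R)^d + R·𝟙` consists of good
sites. [folklore] -/
theorem card_goodSites_ge (d : ℕ) (S : Finset (ZdEdge d)) (R : ℕ)
    (hRS : ∀ e ∈ S, ∀ i, -(R : ℤ) ≤ e.1 i ∧ e.1 i ≤ R) (n : ℕ) (hn : 2 * R ≤ n) :
    (n - 2 * R) ^ d ≤ #((halfOpenBox d n).filter (fun x => S.image (fun e => (e.1 + x, e.2)) ⊆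
      halfOpenBox d (n + 1) ×ˢ (Finset.univ : Finset (Fin d)))) := by
  classical
  set c : Site d := fun _ => (R : ℤ) with hc
  have hinj : Function.Injective (fun y : Site d => y + c) := add_left_injective c
  rw [← Literature.Probability.LatticeModels.card_halfOpenBox d (n - 2 * R),
    ← Finset.card_image_of_injective (halfOpenBox d (n - 2 * R)) hinj]
  refine Finset.card_le_card ?_
  intro z hz
  rw [Finset.mem_image] at hz
  obtain ⟨y, hy, rfl⟩ := hz
  rw [Literature.Probability.LatticeModels.mem_halfOpenBox] at hy
  rw [Finset.mem_filter, Literature.Probability.LatticeModels.mem_halfOpenBox,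
    Finset.image_subset_iff]
  refine ⟨fun i => ?_, fun e he => ?_⟩
  · have h := hy i
    simp only [Pi.add_apply, hc]
    omega
  · rw [Finset.mem_product, Literature.Probability.LatticeModels.mem_halfOpenBox]
    refine ⟨fun i => ?_, Finset.mem_univ _⟩
    have h := hy i
    have h' := hRS e he i
    simp only [Pi.add_apply, hc]
    omega

/-- **Upper bound on the number of good sites**: at most `#[0, n)^d = n^d`. [folklore] -/
theorem card_goodSites_le (d : ℕ) (S : Finset (ZdEdge d)) (n : ℕ) :
    #((halfOpenBox d n).filter (fun x => S.image (fun e => (e.1 + x, e.2)) ⊆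
      halfOpenBox d (n + 1) ×ˢ (Finset.univ : Finset (Fin d)))) ≤ n ^ d :=
  (Finset.card_filter_le _ _).trans (Literature.Probability.LatticeModels.card_halfOpenBox d n).le

/-- **A sup-norm bound on the base points of a finite edge set.** [folklore] -/
theorem exists_bound_basePoints (d : ℕ) (S : Finset (ZdEdge d)) :
    ∃ R : ℕ, ∀ e ∈ S, ∀ i, -(R : ℤ) ≤ e.1 i ∧ e.1 i ≤ R := by
  classical
  refine ⟨S.sup (fun e => Finset.univ.sup fun i => (e.1 i).natAbs), fun e he i => ?_⟩
  have h1 : (e.1 i).natAbs ≤ Finset.univ.sup (fun i => (e.1 i).natAbs) :=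
    Finset.le_sup (f := fun i => (e.1 i).natAbs) (Finset.mem_univ i)
  have h2 : Finset.univ.sup (fun i => (e.1 i).natAbs) ≤
      S.sup (fun e => Finset.univ.sup fun i => (e.1 i).natAbs) :=
    Finset.le_sup (f := fun e : ZdEdge d => Finset.univ.sup fun i => (e.1 i).natAbs) he
  omega

/-- **`(n - 2R)/(n + 1) → 1`.** [folklore] -/
theorem tendsto_sub_div_add_one (R : ℕ) :
    Tendsto (fun n : ℕ => ((n : ℝ) - 2 * R) / ((n : ℝ) + 1)) atTop (𝓝 1) := by
  have h0 := tendsto_one_div_add_atTop_nhds_zero_nat (𝕜 := ℝ)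
  have h2 : Tendsto (fun n : ℕ => 1 - (2 * (R : ℝ) + 1) * (1 / ((n : ℝ) + 1))) atTop
      (𝓝 (1 - (2 * (R : ℝ) + 1) * 0)) :=
    tendsto_const_nhds.sub (tendsto_const_nhds.mul h0)
  rw [mul_zero, sub_zero] at h2
  refine h2.congr' (Eventually.of_forall fun n => ?_)
  have : ((n : ℝ) + 1) ≠ 0 := by positivity
  field_simp
  ring

/-- **Asymptotically all sites are good (T4).**  For a fixed finite edge set `S`, the number of
sites `x ∈ [0, n)^d` whose translate `S + x` stays inside the edge box `[0, n+1)^d × {directions}`,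
divided by `(n + 1)^d`, tends to `1`. [folklore] -/
theorem tangent_card_goodSites_tendsto : ∀ (d : ℕ) (S : Finset (ZdEdge d)), Filter.Tendsto (fun n : ℕ => (#((halfOpenBox d n).filter (fun x => S.image (fun e => (e.1 + x, e.2)) ⊆ halfOpenBox d (n + 1) ×ˢ (Finset.univ : Finset (Fin d)))) : ℝ) / (((n : ℝ) + 1) ^ d)) Filter.atTop (nhds 1) := by
  intro d S
  classical
  obtain ⟨R, hRS⟩ := exists_bound_basePoints d S
  have hlim : Tendsto (fun n : ℕ => (((n : ℝ) - 2 * R) / ((n : ℝ) + 1)) ^ d) atTop (𝓝 1) := by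
    simpa using (tendsto_sub_div_add_one R).pow d
  refine tendsto_of_tendsto_of_tendsto_of_le_of_le' hlim tendsto_const_nhds ?_
    (Eventually.of_forall fun n => ?_)
  · filter_upwards [eventually_ge_atTop (2 * R)] with n hn
    rw [div_pow]
    refine div_le_div_of_nonneg_right ?_ (by positivity)
    have h := card_goodSites_ge d S R hRS n hn
    calc ((n : ℝ) - 2 * R) ^ d = (((n - 2 * R : ℕ) : ℝ)) ^ d := by
          rw [Nat.cast_sub hn]; push_cast; ring
      _ ≤ _ := by exact_mod_cast h
  · rw [div_le_one (by positivity)]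
    calc (#((halfOpenBox d n).filter (fun x => S.image (fun e => (e.1 + x, e.2)) ⊆
            halfOpenBox d (n + 1) ×ˢ (Finset.univ : Finset (Fin d)))) : ℝ) ≤ (n : ℝ) ^ d := by
          exact_mod_cast card_goodSites_le d S n
      _ ≤ ((n : ℝ) + 1) ^ d := by
          gcongr; linarith

end Summit.QuantumFields.YangMills.Theorems.FibreToTorus
end
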